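import Summits.AtomisticToContinuum.HydrodynamicLimit.Theorems.JParityClosureLocalSecondLawEquilibriumDefs
import Summits.AtomisticToContinuum.HydrodynamicLimit.Theorems.JParityClosureLocalSecondLawEquilibriumColdBallsFrozenTools
import Literature.MathematicalPhysics.KineticTheory.HardSphereUniformGas
import Mathlib.Analysis.SpecificLimits.Normed

/-!
# Cold balls (lead c3): rung-0 transfer lemmas and the dyadic shells

Stub `eq_coldBalls` (crux `JParityClosure.LocalSecondLaw`, stmt-AtomisticToContinuum-13081, line `exact-entropy-ledger-three-passivities`).
* measurability of `coldTerm` in the configuration;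
* the rung-0 disintegration of the homogeneous local Gibbs law (`lintegral_lawC_eq_prod`: `E[F] = ∫(∫F∘zip dQ)dPos`, from
  `localGibbsMeasure_rung0_eq_map`) and its position-observable form (`lintegral_lawC_positions`);
* the occupation bound of a position set `Pos{∃ k, x_k ∈ S} ≤ min(1, (N+1)|S|)` GIVEN the uniform one-particle marginal
  (`lintegral_exists_mem_le`);
* the dyadic shells of the cone weight: measurability, the summable majorant of the shell series, the bookkeeping
  `(N+1)⁻¹ min(1,(N+1)y) = min((N+1)⁻¹, y)`, and the geometric shell volumes `|shell m| ≤ 2πr³·2⁻ᵐ` (registered sub-goal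
  `volume_shell_le`: difference of two minimal-image balls, `0 < r < 1/2`).

References: H. Spohn, *Large Scale Dynamics of Interacting Particles* (1991), Part I §2.3 (homogeneous Gibbs law: configurational
Gibbs measure ⊗ product Maxwellian); S. Goldstein, J. L. Lebowitz, Physica D 193 (2004) 53–66 (typicality of coarse-grained
observables at equilibrium).
-/

noncomputable section

namespace Summit.AtomisticToContinuum.HydrodynamicLimit.Theorems.LocalSecondLawEquilibrium.ColdFrozen

open scoped BigOperators Topology Classical MeasureTheory ENNReal InnerProductSpace
open Filter Set MeasureTheory ProbabilityTheory
open Literature.MathematicalPhysics.KineticTheory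
open Literature.Analysis.FluidPDE
open Summit.AtomisticToContinuum.HydrodynamicLimit.Theorems.LocalSecondLawNegative
open Summit.AtomisticToContinuum.HydrodynamicLimit.Theorems.LocalSecondLawLedger
open Summit.AtomisticToContinuum.HydrodynamicLimit.Theorems.LocalSecondLawLedger.L

variable {N : ℕ}


/-! ## Measurability of the cold-ball statistic and the rung-0 transfer lemmas -/

/-- The cold-ball statistic is Borel in the configuration at a fixed field point. -/
theorem measurable_coldTerm (Θ r : ℝ) (x : T3) : Measurable fun w : Phase N => coldTerm Θ r w x := by
  obtain ⟨hρ, -, -⟩ := measurable_fields_section (N := N) r x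
  have hθ := measurable_thetaC_section (N := N) r x
  unfold coldTerm
  exact (hρ.mul (measurable_const.add ((Real.measurable_log.comp hθ).pow_const 2))).mul
    ((continuous_cutTheta Θ).measurable.comp hθ)

/-- **Rung-0 disintegration of a configuration observable**: under the homogeneous law,
`E[F] = ∫ (∫ F(zip(xs, vs)) dQ(vs)) dPos(xs)` with `Q` the product Maxwellian and `Pos` the configurational Gibbs measure. -/
theorem lintegral_lawC_eq_prod {σ a Θ : ℝ} (ū : V3) (ha : 0 < a) (hΘ : 0 < Θ) (N : ℕ) (Φ : Flow σ N)
    {F : Phase N → ℝ≥0∞} (hF : Measurable F) :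
    ∫⁻ w, F w ∂(lawC σ a Θ ū N Φ) =
      ∫⁻ xs, ∫⁻ vs, F (zipConfig (xs, vs)) ∂(Measure.pi fun _ : Fin (N + 1) => gaussMeasure ū Θ)
        ∂(posGibbsMeasure (fun _ : T3 => a) (hsDiameter σ N) (N + 1)) := by
  change ∫⁻ w, F w ∂(localGibbsLaw σ (fun _ => a) (fun _ => ū) (fun _ => Θ) N Φ) = _
  rw [localGibbsLaw_eq, localGibbsMeasure_rung0_eq_map σ ha.le hΘ ū N, lintegral_map hF measurable_zipConfig,
    lintegral_prod (fun p => F (zipConfig p)) (hF.comp measurable_zipConfig).aemeasurable]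

/-- **Position observables**: under the homogeneous law, `E[g(positions)] = ∫ g dPos`. -/
theorem lintegral_lawC_positions {σ a Θ : ℝ} (ū : V3) (ha : 0 < a) (hΘ : 0 < Θ) (N : ℕ) (Φ : Flow σ N)
    {g : (Fin (N + 1) → T3) → ℝ≥0∞} (hg : Measurable g) :
    ∫⁻ w, g (fun i => (w i).1) ∂(lawC σ a Θ ū N Φ) =
      ∫⁻ xs, g xs ∂(posGibbsMeasure (fun _ : T3 => a) (hsDiameter σ N) (N + 1)) := by
  have hF : Measurable fun w : Phase N => g (fun i => (w i).1) :=
    hg.comp (measurable_pi_lambda _ fun i => (measurable_pi_apply i).fst)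
  rw [lintegral_lawC_eq_prod ū ha hΘ N Φ hF]
  refine lintegral_congr fun xs => ?_
  have : (fun vs : Fin (N + 1) → V3 => g (fun i => ((zipConfig (xs, vs)) i).1)) = fun _ => g xs := by
    funext vs; rfl
  rw [this, lintegral_const, measure_univ, mul_one]

/-- **Occupation bound for a position shell**: `Pos{∃ k, x_k ∈ S} ≤ (N+1)·|S|` (union bound + the uniform
one-particle marginal of the homogeneous law, `eq_uniformMarginal`), and `≤ 1`. -/
theorem lintegral_exists_mem_le {σ a Θ : ℝ} (ū : V3) (ha : 0 < a) (hΘ : 0 < Θ) (hσhalf : σ ≤ 1 / 2) (N : ℕ)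
    (Φ : Flow σ N)
    (hMarg : ∀ (f : T3 → ℝ≥0∞), Measurable f →
      ∫⁻ z, ∑ i : Fin (N + 1), f (z i).1 ∂(lawC σ a Θ ū N Φ) = ((N + 1 : ℕ) : ℝ≥0∞) * ∫⁻ y : T3, f y)
    {S : Set T3} (hS : MeasurableSet S) :
    ∫⁻ xs, {xs : Fin (N + 1) → T3 | ∃ k, xs k ∈ S}.indicator 1 xs
        ∂(posGibbsMeasure (fun _ : T3 => a) (hsDiameter σ N) (N + 1)) ≤
      min 1 (((N + 1 : ℕ) : ℝ≥0∞) * volume S) := by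
  haveI : IsProbabilityMeasure (posGibbsMeasure (fun _ : T3 => a) (hsDiameter σ N) (N + 1)) :=
    isProbabilityMeasure_posGibbsMeasure continuous_const (fun _ => ha) hσhalf N
  refine le_min ?_ ?_
  · calc ∫⁻ xs, {xs : Fin (N + 1) → T3 | ∃ k, xs k ∈ S}.indicator 1 xs
          ∂(posGibbsMeasure (fun _ : T3 => a) (hsDiameter σ N) (N + 1))
        ≤ ∫⁻ _xs, 1 ∂(posGibbsMeasure (fun _ : T3 => a) (hsDiameter σ N) (N + 1)) :=
          lintegral_mono fun xs => Set.indicator_apply_le' (fun _ => le_rfl) (fun _ => bot_le)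
      _ = 1 := by rw [lintegral_const, measure_univ, mul_one]
  · have hpt : ∀ xs : Fin (N + 1) → T3, {xs : Fin (N + 1) → T3 | ∃ k, xs k ∈ S}.indicator (1 : (Fin (N + 1) → T3) → ℝ≥0∞) xs ≤
        ∑ i : Fin (N + 1), S.indicator (1 : T3 → ℝ≥0∞) (xs i) := by
      intro xs
      by_cases h : xs ∈ {xs : Fin (N + 1) → T3 | ∃ k, xs k ∈ S}
      · obtain ⟨k, hk⟩ := h
        rw [Set.indicator_of_mem (show xs ∈ {xs : Fin (N + 1) → T3 | ∃ k, xs k ∈ S} from ⟨k, hk⟩)]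
        calc (1 : (Fin (N + 1) → T3) → ℝ≥0∞) xs = S.indicator (1 : T3 → ℝ≥0∞) (xs k) := by
              rw [Set.indicator_of_mem hk]; rfl
          _ ≤ ∑ i : Fin (N + 1), S.indicator (1 : T3 → ℝ≥0∞) (xs i) :=
              Finset.single_le_sum (f := fun i => S.indicator (1 : T3 → ℝ≥0∞) (xs i)) (fun i _ => bot_le)
                (Finset.mem_univ k)
      · rw [Set.indicator_of_notMem h]; exact bot_le
    have hg : Measurable fun xs : Fin (N + 1) → T3 => ∑ i : Fin (N + 1), S.indicator (1 : T3 → ℝ≥0∞) (xs i) :=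
      Finset.measurable_sum _ fun i _ => (measurable_one.indicator hS).comp (measurable_pi_apply i)
    calc ∫⁻ xs, {xs : Fin (N + 1) → T3 | ∃ k, xs k ∈ S}.indicator 1 xs
          ∂(posGibbsMeasure (fun _ : T3 => a) (hsDiameter σ N) (N + 1))
        ≤ ∫⁻ xs, ∑ i : Fin (N + 1), S.indicator 1 (xs i)
            ∂(posGibbsMeasure (fun _ : T3 => a) (hsDiameter σ N) (N + 1)) := lintegral_mono hpt
      _ = ∫⁻ z, ∑ i : Fin (N + 1), S.indicator 1 (z i).1 ∂(lawC σ a Θ ū N Φ) :=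
          (lintegral_lawC_positions ū ha hΘ N Φ hg).symm
      _ = ((N + 1 : ℕ) : ℝ≥0∞) * ∫⁻ y : T3, S.indicator 1 y := hMarg _ (measurable_one.indicator hS)
      _ = ((N + 1 : ℕ) : ℝ≥0∞) * volume S := by rw [lintegral_indicator_one hS]

/-! ## The dyadic shells and the real shell series -/

/-- The `m`-th dyadic shell of the cone weight around the field point `x₀` (a Borel set). -/
theorem measurableSet_shell (r : ℝ) (m : ℕ) (x₀ : T3) :
    MeasurableSet {y : T3 | 3 / (Real.pi * r ^ 3) * (2 : ℝ)⁻¹ ^ (m + 1) < cone r y x₀ ∧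
      cone r y x₀ ≤ 3 / (Real.pi * r ^ 3) * (2 : ℝ)⁻¹ ^ m} := by
  have hc : Continuous fun y : T3 => cone r y x₀ := continuous_cone_comp r continuous_id continuous_const
  exact (measurableSet_lt measurable_const hc.measurable).inter (measurableSet_le hc.measurable measurable_const)

/-- Summability of the dominating shell series `(p + q (log⁺(κ 2^{m+1}))²) · c · 2^{-m}`. -/
theorem summable_shellMajorant {p q c κ : ℝ} (hκ : 0 < κ) :
    Summable fun m : ℕ => (p + q * (max 0 (Real.log (κ * 2 ^ (m + 1)))) ^ 2) * (c * (2 : ℝ)⁻¹ ^ m) := by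
  -- polynomial bound of the logarithm: `log⁺(κ 2^{m+1})² ≤ 2L² + 2 log²2 · m²`... we dominate by a polynomial times geometric
  set L : ℝ := |Real.log κ| + Real.log 2 with hL
  have hlog2 : 0 ≤ Real.log 2 := Real.log_nonneg one_le_two
  have hbound : ∀ m : ℕ, (max 0 (Real.log (κ * 2 ^ (m + 1)))) ^ 2 ≤ 2 * L ^ 2 + 2 * Real.log 2 ^ 2 * (m : ℝ) ^ 2 := by
    intro m
    have h1 : max 0 (Real.log (κ * 2 ^ (m + 1))) ≤ L + Real.log 2 * m := by
      rw [Real.log_mul hκ.ne' (by positivity), Real.log_pow]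
      push_cast
      refine max_le (by positivity) ?_
      rw [hL]; nlinarith [le_abs_self (Real.log κ)]
    have h0 : 0 ≤ max 0 (Real.log (κ * 2 ^ (m + 1))) := le_max_left _ _
    have h2 := pow_le_pow_left₀ h0 h1 2
    nlinarith [sq_nonneg (L - Real.log 2 * m)]
  have hgeo : Summable fun m : ℕ => ((2 : ℝ)⁻¹) ^ m := summable_geometric_of_lt_one (by norm_num) (by norm_num)
  have hpoly : Summable fun m : ℕ => ((m : ℝ) ^ 2 : ℝ) * ((2 : ℝ)⁻¹) ^ m :=
    summable_pow_mul_geometric_of_norm_lt_one 2 (by rw [norm_inv, Real.norm_two]; norm_num)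
  have hdom : Summable fun m : ℕ =>
      (|p| + |q| * (2 * L ^ 2)) * (|c| * (2 : ℝ)⁻¹ ^ m) + |q| * (2 * Real.log 2 ^ 2) * |c| * ((m : ℝ) ^ 2 * (2 : ℝ)⁻¹ ^ m) :=
    ((hgeo.mul_left _).mul_left _).add (hpoly.mul_left _)
  refine hdom.of_norm_bounded (fun m => ?_)
  have hgm : 0 ≤ (2 : ℝ)⁻¹ ^ m := by positivity
  have h0 : 0 ≤ max 0 (Real.log (κ * 2 ^ (m + 1))) := le_max_left _ _
  rw [Real.norm_eq_abs, abs_mul, abs_mul, abs_of_nonneg hgm]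
  have hA : |p + q * (max 0 (Real.log (κ * 2 ^ (m + 1)))) ^ 2| ≤
      |p| + |q| * (2 * L ^ 2) + |q| * (2 * Real.log 2 ^ 2) * (m : ℝ) ^ 2 := by
    refine (abs_add_le _ _).trans ?_
    rw [abs_mul, abs_of_nonneg (pow_nonneg h0 2)]
    nlinarith [hbound m, abs_nonneg q]
  calc |p + q * (max 0 (Real.log (κ * 2 ^ (m + 1)))) ^ 2| * (|c| * (2 : ℝ)⁻¹ ^ m)
      ≤ (|p| + |q| * (2 * L ^ 2) + |q| * (2 * Real.log 2 ^ 2) * (m : ℝ) ^ 2) * (|c| * (2 : ℝ)⁻¹ ^ m) :=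
        mul_le_mul_of_nonneg_right hA (by positivity)
    _ = _ := by ring


/-! ## Elementary real bookkeeping of the shell terms -/

/-- `(N+1)⁻¹ · min(1, (N+1)·y) = min((N+1)⁻¹, y)`. -/
theorem inv_mul_min_one (n : ℕ) (y : ℝ) :
    ((n + 1 : ℕ) : ℝ)⁻¹ * min 1 (((n + 1 : ℕ) : ℝ) * y) = min (((n + 1 : ℕ) : ℝ)⁻¹) y := by
  have hn : (0 : ℝ) < ((n + 1 : ℕ) : ℝ) := by positivity
  rcases le_total 1 (((n + 1 : ℕ) : ℝ) * y) with h | h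
  · have hy : ((n + 1 : ℕ) : ℝ)⁻¹ ≤ y := by
      rw [inv_eq_one_div, div_le_iff₀ hn]; linarith
    rw [min_eq_left h, min_eq_left hy, mul_one]
  · have hy : y ≤ ((n + 1 : ℕ) : ℝ)⁻¹ := by
      rw [inv_eq_one_div, le_div_iff₀ hn]; linarith
    rw [min_eq_right h, min_eq_right hy, ← mul_assoc, inv_mul_cancel₀ hn.ne', one_mul]

/-! ## The dyadic shells have geometric volumes -/

/-- Membership in the `m`-th shell pins the distance to the field point into the annulus
`r(1 − 2^{-m}) ≤ d < r(1 − 2^{-(m+1)})`. -/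
theorem shell_subset_annulus {r : ℝ} (hr : 0 < r) (m : ℕ) (x₀ : T3) :
    {y : T3 | 3 / (Real.pi * r ^ 3) * (2 : ℝ)⁻¹ ^ (m + 1) < cone r y x₀ ∧
        cone r y x₀ ≤ 3 / (Real.pi * r ^ 3) * (2 : ℝ)⁻¹ ^ m} ⊆
      {y : T3 | Torus.euclidDist y x₀ < r * (1 - (2 : ℝ)⁻¹ ^ (m + 1))} \
        {y : T3 | Torus.euclidDist y x₀ < r * (1 - (2 : ℝ)⁻¹ ^ m)} := by
  intro y hy
  obtain ⟨h1, h2⟩ := hy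
  have hB : 0 < 3 / (Real.pi * r ^ 3) := by positivity
  unfold cone at h1 h2
  have h1' : (2 : ℝ)⁻¹ ^ (m + 1) < max (1 - Torus.euclidDist y x₀ / r) 0 := lt_of_mul_lt_mul_left h1 hB.le
  have h2' : max (1 - Torus.euclidDist y x₀ / r) 0 ≤ (2 : ℝ)⁻¹ ^ m := le_of_mul_le_mul_left h2 hB
  have ht : (0 : ℝ) < (2 : ℝ)⁻¹ ^ (m + 1) := by positivity
  refine ⟨?_, ?_⟩
  · show Torus.euclidDist y x₀ < r * (1 - (2 : ℝ)⁻¹ ^ (m + 1))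
    rcases lt_max_iff.1 h1' with h | h
    · rw [lt_sub_comm, div_lt_iff₀ hr] at h; linarith
    · linarith
  · show ¬ (Torus.euclidDist y x₀ < r * (1 - (2 : ℝ)⁻¹ ^ m))
    intro hlt
    have h3 : 1 - Torus.euclidDist y x₀ / r ≤ (2 : ℝ)⁻¹ ^ m := (le_max_left _ _).trans h2'
    rw [sub_le_comm, le_div_iff₀ hr] at h3
    linarith

/-- **Shell volumes**: `|shell m| ≤ 2π r³ · 2^{-m}` for `0 < r < 1/2` (difference of two minimal-image balls). -/
theorem volume_shell_le :
    ∀ {r : ℝ}, 0 < r → r < 1 / 2 → ∀ (m : ℕ) (x₀ : T3), volume {y : T3 | 3 / (Real.pi * r ^ 3) * (2 : ℝ)⁻¹ ^ (m + 1) < cone r y x₀ ∧ cone r y x₀ ≤ 3 / (Real.pi * r ^ 3) * (2 : ℝ)⁻¹ ^ m} ≤ ENNReal.ofReal (2 * Real.pi * r ^ 3 * (2 : ℝ)⁻¹ ^ m) := by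
  intro r hr hr2 m x₀
  set r₁ : ℝ := r * (1 - (2 : ℝ)⁻¹ ^ (m + 1)) with hr₁
  set r₂ : ℝ := r * (1 - (2 : ℝ)⁻¹ ^ m) with hr₂
  have ht1 : (2 : ℝ)⁻¹ ^ (m + 1) ≤ 1 := pow_le_one₀ (by norm_num) (by norm_num)
  have ht2 : (2 : ℝ)⁻¹ ^ m ≤ 1 := pow_le_one₀ (by norm_num) (by norm_num)
  have htt : (2 : ℝ)⁻¹ ^ (m + 1) ≤ (2 : ℝ)⁻¹ ^ m := pow_le_pow_of_le_one (by norm_num) (by norm_num) (Nat.le_succ m)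
  have hr₁0 : 0 ≤ r₁ := by rw [hr₁]; exact mul_nonneg hr.le (by linarith)
  have hr₂0 : 0 ≤ r₂ := by rw [hr₂]; exact mul_nonneg hr.le (by linarith)
  have hr₂₁ : r₂ ≤ r₁ := by rw [hr₁, hr₂]; exact mul_le_mul_of_nonneg_left (by linarith) hr.le
  have hr₁r : r₁ ≤ r := by rw [hr₁]; nlinarith [pow_pos (by norm_num : (0 : ℝ) < 2⁻¹) (m + 1)]
  have hr₁half : r₁ < 1 / 2 := hr₁r.trans_lt hr2
  have hr₂half : r₂ < 1 / 2 := hr₂₁.trans_lt hr₁half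
  have hball : ∀ {ρ : ℝ}, 0 ≤ ρ → ρ < 1 / 2 →
      volume {y : T3 | Torus.euclidDist y x₀ < ρ} = ENNReal.ofReal (ρ ^ 3 * (Real.pi * 4 / 3)) := by
    intro ρ hρ0 hρ
    rw [Torus.volume_euclidDist_lt hρ x₀, EuclideanSpace.volume_ball_fin_three, ← ENNReal.ofReal_pow hρ0,
      ← ENNReal.ofReal_mul (by positivity)]
  have hsub2 : {y : T3 | Torus.euclidDist y x₀ < r₂} ⊆ {y : T3 | Torus.euclidDist y x₀ < r₁} :=
    fun y (hy : Torus.euclidDist y x₀ < r₂) => show Torus.euclidDist y x₀ < r₁ from hy.trans_le hr₂₁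
  have hmeas2 : MeasurableSet {y : T3 | Torus.euclidDist y x₀ < r₂} := isOpen_ball_euclidDist x₀ r₂ |>.measurableSet
  calc volume {y : T3 | 3 / (Real.pi * r ^ 3) * (2 : ℝ)⁻¹ ^ (m + 1) < cone r y x₀ ∧
          cone r y x₀ ≤ 3 / (Real.pi * r ^ 3) * (2 : ℝ)⁻¹ ^ m}
      ≤ volume ({y : T3 | Torus.euclidDist y x₀ < r₁} \ {y : T3 | Torus.euclidDist y x₀ < r₂}) :=
        measure_mono (shell_subset_annulus hr m x₀)
    _ = volume {y : T3 | Torus.euclidDist y x₀ < r₁} - volume {y : T3 | Torus.euclidDist y x₀ < r₂} :=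
        measure_sdiff hsub2 hmeas2.nullMeasurableSet (by rw [hball hr₂0 hr₂half]; exact ENNReal.ofReal_ne_top)
    _ = ENNReal.ofReal (r₁ ^ 3 * (Real.pi * 4 / 3) - r₂ ^ 3 * (Real.pi * 4 / 3)) := by
        rw [hball hr₁0 hr₁half, hball hr₂0 hr₂half, ENNReal.ofReal_sub _ (by positivity)]
    _ ≤ ENNReal.ofReal (2 * Real.pi * r ^ 3 * (2 : ℝ)⁻¹ ^ m) := by
        refine ENNReal.ofReal_le_ofReal ?_
        -- r₁³ − r₂³ ≤ 3 r₁² (r₁ − r₂) ≤ 3 r² · r 2^{-(m+1)}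
        have hdiff : r₁ - r₂ = r * (2 : ℝ)⁻¹ ^ (m + 1) := by rw [hr₁, hr₂]; ring
        have hcube : r₁ ^ 3 - r₂ ^ 3 ≤ 3 * r₁ ^ 2 * (r₁ - r₂) := by
          nlinarith [mul_nonneg hr₂0 (mul_nonneg (sub_nonneg.2 hr₂₁) (sub_nonneg.2 hr₂₁)),
            mul_nonneg hr₁0 (mul_nonneg (sub_nonneg.2 hr₂₁) (sub_nonneg.2 hr₂₁))]
        have hsq : r₁ ^ 2 ≤ r ^ 2 := pow_le_pow_left₀ hr₁0 hr₁r 2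
        have hpow : (2 : ℝ)⁻¹ ^ (m + 1) = (2 : ℝ)⁻¹ ^ m * 2⁻¹ := pow_succ _ _
        calc r₁ ^ 3 * (Real.pi * 4 / 3) - r₂ ^ 3 * (Real.pi * 4 / 3) = (Real.pi * 4 / 3) * (r₁ ^ 3 - r₂ ^ 3) := by ring
          _ ≤ (Real.pi * 4 / 3) * (3 * r ^ 2 * (r * (2 : ℝ)⁻¹ ^ (m + 1))) := by
              refine mul_le_mul_of_nonneg_left (hcube.trans ?_) (by positivity)
              rw [hdiff]
              exact mul_le_mul_of_nonneg_right (mul_le_mul_of_nonneg_left hsq (by norm_num)) (by positivity)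
          _ = 2 * Real.pi * r ^ 3 * (2 : ℝ)⁻¹ ^ m := by rw [hpow]; ring


end Summit.AtomisticToContinuum.HydrodynamicLimit.Theorems.LocalSecondLawEquilibrium.ColdFrozen

end
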